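import Summits.ABC.IUTFork.LDHGenuineHullRegimeSzpiroSlack
import Summits.ABC.IUTFork.LDHSlotResiduePointPair
import Literature.IUT.LogVolume.PilotSlotResidueMixedShare
import HarnessLib

/-!
# The fork at [IUTchIII] Corollary 3.12, L-DH level, READING (U): the (U)-hull estimate with print's `B_III` FOLLOWS from
# «Pr-weighted local height of `j_E` at the MIXED primes of `F_mod` ≤ full slack of `B_III`» — the prove-direction of the
# Szpiro-type certificate in the SAME currency as the necessity (abc-iut cell, R2 S-chain team seat abc-iut-s2-p1; crux
# ThetaPartII = stmt-ABC-19678; CONE binder `hvol` / `hreg` of `abc_of_S_v3` / `abc_of_S_v4`)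

Record-only PROOF file (D-0012) of the abc-iut cell; TAKES NO SIDE on [IUTchIII] Cor. 3.12 or on the (U)/(P) readings of
"−|log(Θ)|". Mochizuki, *Inter-universal Teichmüller theory IV* (RIMS manuscript Apr. 2020 = PRIMS **57** (2021)), Thm. 1.10 proof
Steps (ii)–(viii) pp. 24–30 (Step (v) pp. 27–28: "`i†` to be `j`", symmetrisation in `i† ∈ I`); Dupuy–Hilado [DupuyHilado2025] §3.3
(`P_q = Σ_{v∈S} ord_v(q_v)/(2l)·[v]`, `ord_v(q_v) = −ord_v(j_E)`), §3.6 (`Pr(v) = n_v/[F_mod:ℚ]`), §4.7, §4.11–4.12.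

THE OBSERVATION (sequel to abc-iut-s2-p1's `LDHGenuineHullRegimeSzpiroSlack`, composing abc-iut-s2-p2's
`PilotData.slotResidue_le_mixedShare` BY NAME). The slot residue of a datum vanishes at the SLOT-CONSTANT support primes and is at
most the whole `p`-part `c_ℓ·μ̄_p` of `deĝ̲_lgp(P_Θ)` at the others (`c_ℓ = (ℓ⋆+1)(2ℓ⋆+1)/6 = l(l+1)/12`,
`μ̄_p = Σ_{v|p} P_q(v)·ln N(v)/n_v·Pr(v)`), so the sufficient condition «slot residue ≤ full slack of `B_III`» of
`hullEstimateOf_BIII_of_slotResidue_le_szpiroSlack` is implied by a condition on the MIXED primes only: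

* `PointDict.hullEstimateOf_BIII_of_mixedShare_le_szpiroSlack` — for `λ ∈ U_P` minimal, `l ≥ 7`, a datum `T` at `(P,l)` and ANY
  set `C` of support primes at which `c312-d1`'s `logQloc` is constant over the places of `F_mod` (v4's regime vocabulary):
  `(l(l+1)/12)·Σ_{p ∈ T(I)∖C} μ̄_p(T) ≤ (l+1)/4·{(4(d_mod−1)/l)·(log-diff + log-cond) + (20/3)·log(d*·l)·(π(d*·l) − #{p ∈ T(I) : p ≤ d*·l})}`
  implies `T.HullEstimateOf (B_III P l)`;
* `PointDict.hullEstimateOf_BIII_of_mixedLocalHeight_le_szpiroSlack` — the same in the PRINTED quantities of the datum (abc-iut-S7's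
  `PointDict.mu_eq`): `((l+1)/24)·Σ_{p ∈ T(I)∖C} Σ_{v | p, v ∈ 𝕍^bad_mod} Pr(v)·(−ord_v(j_E))·ln N(v)/n_v ≤ full slack` suffices — the
  `Pr`-weighted local heights of the `q`-parameter at the mixed primes of `F_mod = ℚ(j_E)`, exactly the currency of the NECESSITY half
  (abc-iut-S7 `ordPair_le_of_hullVolumeAtDatum`, abc-iut-s2-p2 `mixedShare_le_of_hullVolumeAtDatum`, abc-iut-s2-p5's datum-free form);
  primed form `…_szpiroSlack'`: the canonical sum over the MIXED support primes (`q`-orders not constant over the places of `F_mod`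
  above `p` — the prime-by-prime negation of v4's `hreg` regime clause).

READING (for the planners; nothing asserted about print). With `δ = B_III(P,l)`: NECESSITY says the (U)-binder at `(P,l)` forces
«((l+1)/24)·(mixed local height at p)·(1 − O(ℓ⁻²ω_p⁻³)) ≤ B_III», SUFFICIENCY (this file) says «((l+1)/24)·(total mixed local height) ≤
B_III − (print-shaped per-image budget)» forces the binder — ONE quantity on both sides, the weighted local height of `j(λ)` at the primes
of `F_mod` that split into places of different `q`-order; between the two bounds sits only the Step (ii)(iii)(viii) per-image budget
`((l+1)/4)·{(1+(4+8d_mod)/l)·(log-diff+log-cond) + 2 log l + 52 + (20/3)·log(d*l)·#{p ∈ T(I) ≤ d*l}}`. HONEST SCOPE: arithmetic on the cell's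
typed constants; no datum constructed; no side taken on Cor. 3.12 / Thm. 1.10; typed ≠ proved. PROOF-ONLY file: no definitions, no named
`Prop` facts. [cite: Mochizuki2012, IUTchIV Thm. 1.10 proof Steps (ii)–(viii) p. 24–30] [cite: DupuyHilado2025, §3.3, §3.6, §4.7, §4.11–4.12]
[claim: Mochizuki2012, status: disputed] for every IUT quotation.
-/

noncomputable section

namespace Summit.ABC.IUTFork

open Literature.IUT.HodgeTheaters Literature.IUT.LogVolume NumberField IsDedekindDomain
open Literature.NumberTheory.DiophantineGeometry.GenEll
open scoped Nat.Prime Classical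

namespace PointDict

variable {P : NFPoint} {l : ℕ}

/-- **READING (U): the hull estimate with print's `B_III` from «mixed share ≤ full slack».** For `λ ∈ U_P` (minimally presented),
`l ≥ 7`, a genuine Θ-volume datum `T` at `(P, l)` and any finite set `C` of primes at which the datum's `q`-orders are constant over
the places of `F_mod` (`logQloc p v = logQloc p w`, abc-iut-c312-d1's vocabulary of v4's `hreg`): if
`(l(l+1)/12)·Σ_{p ∈ T(I)∖C} Σ_{v|p} P_q(v)·ln N(v)/n_v·Pr(v) ≤ (l+1)/4·{(4(d_mod−1)/l)·(log-diff + log-cond) + (20/3)·log(d*·l)·(π(d*·l) −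
#{p ∈ T(I) : p ≤ d*·l})}` then `T.HullEstimateOf (B_III P l)`. Composition of abc-iut-s2-p2's `PilotData.slotResidue_le_mixedShare`
(the residue lives on the mixed primes) with `hullEstimateOf_BIII_of_slotResidue_le_szpiroSlack`.
[cite: Mochizuki2012, IUTchIV Thm. 1.10 proof Steps (ii)–(viii) p. 24–30] [cite: DupuyHilado2025, §3.3, §4.7] [claim: Mochizuki2012, status: disputed] -/
theorem hullEstimateOf_BIII_of_mixedShare_le_szpiroSlack (T : Cor22.ThetaVolumeDatumAt P l) (hP : P ∈ UP) (h7 : 7 ≤ l)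
    (C : Finset ℕ)
    (hC : letI := T.instFieldF; letI := T.instNumberFieldF; letI := T.instAlgebraF; letI := T.instFieldK
      letI := T.instNumberFieldK; letI := T.instAlgebraK; letI := T.instFieldFbar; letI := T.instAlgebraFbar
      letI := T.instAlgebraKFbar; letI := T.instIsElliptic
      ∀ p ∈ C, ∀ v w : placesOver (fieldOfModuli T.E) p,
        (DHData.ofInput T.I).logQloc p v = (DHData.ofInput T.I).logQloc p w)
    (h : letI := T.instFieldF; letI := T.instNumberFieldF; letI := T.instAlgebraF; letI := T.instFieldK
      letI := T.instNumberFieldK; letI := T.instAlgebraK; letI := T.instFieldFbar; letI := T.instAlgebraFbar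
      letI := T.instAlgebraKFbar; letI := T.instIsElliptic
      (l : ℝ) * ((l : ℝ) + 1) / 12 *
          ∑ p ∈ T.I.supportPrimes \ C, ∑ v : placesOver (fieldOfModuli T.E) p,
            T.I.X.qPilot v.1 * logNorm (fieldOfModuli T.E) v.1 / (localDegree (fieldOfModuli T.E) v.1 : ℝ)
              * weight (fieldOfModuli T.E) v.1 ≤
        ((l : ℝ) + 1) / 4 * (4 * ((Cor22.dmod P : ℝ) - 1) / l * (P.logDiff + Cor22.logCondAvoid P {2, l})
          + 20 / 3 * Real.log (((2 ^ 12 * 3 ^ 3 * 5 * Cor22.dmod P : ℕ) : ℝ) * l)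
            * ((Nat.primeCounting (2 ^ 12 * 3 ^ 3 * 5 * Cor22.dmod P * l) : ℝ)
              - ((T.I.supportPrimes.filter (· ≤ 2 ^ 12 * 3 ^ 3 * 5 * Cor22.dmod P * l)).card : ℝ)))) :
    T.HullEstimateOf (((l : ℝ) + 1) / 4 * ((1 + 12 * (Cor22.dmod P : ℝ) / l) * (P.logDiff + Cor22.logCondAvoid P {2, l})
      + 2 * Real.log l + 52 + 20 / 3 * Real.log (((2 ^ 12 * 3 ^ 3 * 5 * Cor22.dmod P : ℕ) : ℝ) * (l : ℝ))
        * (Nat.primeCounting (2 ^ 12 * 3 ^ 3 * 5 * Cor22.dmod P * l) : ℝ))) := by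
  letI := T.instFieldF; letI := T.instNumberFieldF; letI := T.instAlgebraF; letI := T.instFieldK
  letI := T.instNumberFieldK; letI := T.instAlgebraK; letI := T.instFieldFbar; letI := T.instAlgebraFbar
  letI := T.instAlgebraKFbar; letI := T.instIsElliptic
  refine hullEstimateOf_BIII_of_slotResidue_le_szpiroSlack T hP h7 (le_trans ?_ h)
  have hprimes : ∀ p ∈ T.I.supportPrimes, p.Prime := fun p hp => T.I.prime_of_mem_supportPrimes hp
  -- `logQloc`-constancy at `p ∈ C` gives `θ_i`-constancy (`θ_i(v) = (i+1)²·μ(v)`, `μ(v) = logQloc(v)/(2l)`)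
  have hC' : ∀ p ∈ C, ∀ (i : Fin T.I.X.lstar) (v w : placesOver (fieldOfModuli T.E) p),
      T.I.X.slotValue i v.1 = T.I.X.slotValue i w.1 := by
    intro p hp i v w
    have hvw := hC p hp v w
    simp only [DHData.logQloc, DHData.ofInput_X] at hvw
    have e1 : ∀ u : placesOver (fieldOfModuli T.E) p, T.I.X.slotValue i u.1 =
        (((i : ℕ) + 1 : ℝ) ^ 2) * (1 / (2 * (T.I.X.l : ℝ)) *
          (T.I.X.qDivisor u.1 * logNorm (fieldOfModuli T.E) u.1 / (localDegree (fieldOfModuli T.E) u.1 : ℝ))) := by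
      intro u
      rw [PilotData.slotValue_eq_sq_mul, PilotData.qPilot_eq_smul, Finsupp.smul_apply, smul_eq_mul]
      ring
    rw [e1, e1, hvw]
  have hres := T.I.X.slotResidue_le_mixedShare T.I.supportPrimes C hprimes hC'
  rw [avgSq_eq T, ← Finset.mul_sum] at hres
  exact hres

/-- **READING (U): the hull estimate with print's `B_III` from «weighted local height of `j_E` at the MIXED primes ≤ full slack», in
the PRINTED quantities of the datum.** For `λ ∈ U_P` (minimally presented), `l ≥ 7`, a genuine Θ-volume datum `T` at `(P, l)` and any
finite set `C` of primes at which the datum's `q`-orders are constant over the places of `F_mod`: if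
`((l+1)/24)·Σ_{p ∈ T(I)∖C} Σ_{v | p, v ∈ 𝕍^bad_mod} Pr(v)·(−ord_v(j_E))·ln N(v)/n_v ≤ (l+1)/4·{(4(d_mod−1)/l)·(log-diff + log-cond) +
(20/3)·log(d*·l)·(π(d*·l) − #{p ∈ T(I) : p ≤ d*·l})}` then `T.HullEstimateOf (B_III P l)` — the same currency as the necessity half
(abc-iut-S7 `ordPair_le_of_hullVolumeAtDatum`, abc-iut-s2-p2 `mixedShare_le_of_hullVolumeAtDatum`): the `Pr`-weighted local heights of
the `q`-parameter of `E_λ` at the primes of `F_mod = ℚ(j_E)` with places of different `q`-order (`μ_T` read by `PointDict.mu_eq`).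
[cite: Mochizuki2012, IUTchIV Thm. 1.10 proof Steps (ii)–(viii) p. 24–30] [cite: DupuyHilado2025, §3.3, §3.6, §4.7]
[claim: Mochizuki2012, status: disputed] -/
theorem hullEstimateOf_BIII_of_mixedLocalHeight_le_szpiroSlack (T : Cor22.ThetaVolumeDatumAt P l) (hP : P ∈ UP) (h7 : 7 ≤ l)
    (C : Finset ℕ)
    (hC : letI := T.instFieldF; letI := T.instNumberFieldF; letI := T.instAlgebraF; letI := T.instFieldK
      letI := T.instNumberFieldK; letI := T.instAlgebraK; letI := T.instFieldFbar; letI := T.instAlgebraFbar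
      letI := T.instAlgebraKFbar; letI := T.instIsElliptic
      ∀ p ∈ C, ∀ v w : placesOver (fieldOfModuli T.E) p,
        (DHData.ofInput T.I).logQloc p v = (DHData.ofInput T.I).logQloc p w)
    (h : letI := T.instFieldF; letI := T.instNumberFieldF; letI := T.instAlgebraF; letI := T.instFieldK
      letI := T.instNumberFieldK; letI := T.instAlgebraK; letI := T.instFieldFbar; letI := T.instAlgebraFbar
      letI := T.instAlgebraKFbar; letI := T.instIsElliptic
      ((l : ℝ) + 1) / 24 *
          ∑ p ∈ T.I.supportPrimes \ C, ∑ v : placesOver (fieldOfModuli T.E) p,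
            (if v.1 ∈ ThetaData.badPrimesMod T.D then
              weight (fieldOfModuli T.E) v.1 * (((-ord (fieldOfModuli T.E) v.1 (ThetaData.jMod T.E) : ℤ) : ℝ)
                * logNorm (fieldOfModuli T.E) v.1 / (localDegree (fieldOfModuli T.E) v.1 : ℝ))
             else 0) ≤
        ((l : ℝ) + 1) / 4 * (4 * ((Cor22.dmod P : ℝ) - 1) / l * (P.logDiff + Cor22.logCondAvoid P {2, l})
          + 20 / 3 * Real.log (((2 ^ 12 * 3 ^ 3 * 5 * Cor22.dmod P : ℕ) : ℝ) * l)
            * ((Nat.primeCounting (2 ^ 12 * 3 ^ 3 * 5 * Cor22.dmod P * l) : ℝ)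
              - ((T.I.supportPrimes.filter (· ≤ 2 ^ 12 * 3 ^ 3 * 5 * Cor22.dmod P * l)).card : ℝ)))) :
    T.HullEstimateOf (((l : ℝ) + 1) / 4 * ((1 + 12 * (Cor22.dmod P : ℝ) / l) * (P.logDiff + Cor22.logCondAvoid P {2, l})
      + 2 * Real.log l + 52 + 20 / 3 * Real.log (((2 ^ 12 * 3 ^ 3 * 5 * Cor22.dmod P : ℕ) : ℝ) * (l : ℝ))
        * (Nat.primeCounting (2 ^ 12 * 3 ^ 3 * 5 * Cor22.dmod P * l) : ℝ))) := by
  letI := T.instFieldF; letI := T.instNumberFieldF; letI := T.instAlgebraF; letI := T.instFieldK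
  letI := T.instNumberFieldK; letI := T.instAlgebraK; letI := T.instFieldFbar; letI := T.instAlgebraFbar
  letI := T.instAlgebraKFbar; letI := T.instIsElliptic
  refine hullEstimateOf_BIII_of_mixedShare_le_szpiroSlack T hP h7 C hC (le_trans (le_of_eq ?_) h)
  have hl0 : (l : ℝ) ≠ 0 := by exact_mod_cast (show l ≠ 0 by omega)
  -- read `μ_T(v)·Pr(v)` in printed quantities (abc-iut-S7 `mu_eq`) and move `1/(2l)` out: `l(l+1)/12 · 1/(2l) = (l+1)/24`
  have hμ := mu_eq T
  have hterm : ∀ p ∈ T.I.supportPrimes \ C, ∑ v : placesOver (fieldOfModuli T.E) p,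
      T.I.X.qPilot v.1 * logNorm (fieldOfModuli T.E) v.1 / (localDegree (fieldOfModuli T.E) v.1 : ℝ)
        * weight (fieldOfModuli T.E) v.1 =
      1 / (2 * (l : ℝ)) * ∑ v : placesOver (fieldOfModuli T.E) p,
        (if v.1 ∈ ThetaData.badPrimesMod T.D then
          weight (fieldOfModuli T.E) v.1 * (((-ord (fieldOfModuli T.E) v.1 (ThetaData.jMod T.E) : ℤ) : ℝ)
            * logNorm (fieldOfModuli T.E) v.1 / (localDegree (fieldOfModuli T.E) v.1 : ℝ))
         else 0) := by
    intro p _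
    rw [Finset.mul_sum]
    refine Finset.sum_congr rfl fun v _ => ?_
    rw [hμ v.1]
    split_ifs with hv
    · field_simp
    · simp
  rw [Finset.sum_congr rfl hterm, ← Finset.mul_sum]
  field_simp
  ring

/-- **The canonical form: sum over the MIXED support primes.** For `λ ∈ U_P` (minimally presented), `l ≥ 7` and a genuine Θ-volume
datum `T` at `(P, l)`: if `((l+1)/24)·Σ_{p ∈ T(I) mixed} Σ_{v | p, v ∈ 𝕍^bad_mod} Pr(v)·(−ord_v(j_E))·ln N(v)/n_v ≤ full slack of B_III`,
where «`p` mixed» means that the datum's `q`-orders are NOT constant over the places of `F_mod` above `p` (the negation, prime by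
prime, of v4's `hreg` regime clause), then `T.HullEstimateOf (B_III P l)`. At a slot-constant datum (e.g. `d_mod = 1`) the sum is empty
and the condition reads `0 ≤ full slack`. [cite: Mochizuki2012, IUTchIV Thm. 1.10 proof Steps (ii)–(viii) p. 24–30]
[cite: DupuyHilado2025, §3.3, §3.6, §4.7] [claim: Mochizuki2012, status: disputed] -/
theorem hullEstimateOf_BIII_of_mixedLocalHeight_le_szpiroSlack' (T : Cor22.ThetaVolumeDatumAt P l) (hP : P ∈ UP) (h7 : 7 ≤ l)
    (h : letI := T.instFieldF; letI := T.instNumberFieldF; letI := T.instAlgebraF; letI := T.instFieldK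
      letI := T.instNumberFieldK; letI := T.instAlgebraK; letI := T.instFieldFbar; letI := T.instAlgebraFbar
      letI := T.instAlgebraKFbar; letI := T.instIsElliptic
      ((l : ℝ) + 1) / 24 *
          ∑ p ∈ T.I.supportPrimes.filter (fun p => ¬ ∀ v w : placesOver (fieldOfModuli T.E) p,
              (DHData.ofInput T.I).logQloc p v = (DHData.ofInput T.I).logQloc p w),
            ∑ v : placesOver (fieldOfModuli T.E) p,
            (if v.1 ∈ ThetaData.badPrimesMod T.D then
              weight (fieldOfModuli T.E) v.1 * (((-ord (fieldOfModuli T.E) v.1 (ThetaData.jMod T.E) : ℤ) : ℝ)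
                * logNorm (fieldOfModuli T.E) v.1 / (localDegree (fieldOfModuli T.E) v.1 : ℝ))
             else 0) ≤
        ((l : ℝ) + 1) / 4 * (4 * ((Cor22.dmod P : ℝ) - 1) / l * (P.logDiff + Cor22.logCondAvoid P {2, l})
          + 20 / 3 * Real.log (((2 ^ 12 * 3 ^ 3 * 5 * Cor22.dmod P : ℕ) : ℝ) * l)
            * ((Nat.primeCounting (2 ^ 12 * 3 ^ 3 * 5 * Cor22.dmod P * l) : ℝ)
              - ((T.I.supportPrimes.filter (· ≤ 2 ^ 12 * 3 ^ 3 * 5 * Cor22.dmod P * l)).card : ℝ)))) :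
    T.HullEstimateOf (((l : ℝ) + 1) / 4 * ((1 + 12 * (Cor22.dmod P : ℝ) / l) * (P.logDiff + Cor22.logCondAvoid P {2, l})
      + 2 * Real.log l + 52 + 20 / 3 * Real.log (((2 ^ 12 * 3 ^ 3 * 5 * Cor22.dmod P : ℕ) : ℝ) * (l : ℝ))
        * (Nat.primeCounting (2 ^ 12 * 3 ^ 3 * 5 * Cor22.dmod P * l) : ℝ))) := by
  letI := T.instFieldF; letI := T.instNumberFieldF; letI := T.instAlgebraF; letI := T.instFieldK
  letI := T.instNumberFieldK; letI := T.instAlgebraK; letI := T.instFieldFbar; letI := T.instAlgebraFbar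
  letI := T.instAlgebraKFbar; letI := T.instIsElliptic
  refine hullEstimateOf_BIII_of_mixedLocalHeight_le_szpiroSlack T hP h7
    (T.I.supportPrimes.filter (fun p => ∀ v w : placesOver (fieldOfModuli T.E) p,
      (DHData.ofInput T.I).logQloc p v = (DHData.ofInput T.I).logQloc p w))
    (fun p hp => (Finset.mem_filter.1 hp).2) ?_
  rw [← Finset.filter_not]
  exact h

end PointDict

end Summit.ABC.IUTFork

end
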